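import Literature.Computability.Complexity.PromiseCookReductions
import Literature.Computability.Complexity.OracleQueryMap
import Literature.Computability.Complexity.CookReducibilityTransitive
import Literature.Computability.Complexity.UniformProbBlocks
import HarnessLib

/-!
# The machine behind "promise-BPP is closed under Cook reductions" (Goldreich 2006, §1.2)

Trunk toolkit (definitions and their deterministic properties) for the discharge of the named
facts `PromiseProblem.mem_PromiseBPP'_of_cookReducible` / `mem_PromiseP_of_cookReducible` of
`PromiseCookReductions.lean` (O. Goldreich, *On promise problems: a survey*, LNCS 3895 (2006),
§1.2, remark after Def. 3, p. 258: "if `Π` is Cook-reducible to a promise problem in P (or in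
BPP) then `Π` is in P (resp., in BPP)"), carried out in the sibling
`PromiseCookReductionsProofs.lean`. Given a Cook reduction `(M, q)` of promise problems
(`PromiseProblem.CookReducible`, Def. 3 in the transcript model of `Oracle.lean`) and a witness
language `Lamp` (of an amplified probabilistic decider of the padded target problem), this file
builds the deterministic part of the promise-BPP machine for the source problem and proves what
does not involve probability:

* `PromiseCook.dec` — the decoration `⟨w, ⟨a, y⟩⟩ ↦ ⟨⟨y, fstP w⟩, sndP w⟩` of the queries (on the
  outer input `w = ⟨x, R⟩` the query `y` becomes the padded instance `⟨y, x⟩` paired with the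
  coins `R` — the SAME coins for every query), in `FP`;
* `PromiseCook.Kin`, `PromiseCook.Kc` — `M` capped at `q(|x|)`, reading `x = fstP w`, queries
  decorated, clocked at `q(|w|)` rounds (the combinators `capQ`, `comap`, `mapQuery`, `clock` of
  `OracleQueryMap.lean`); `isPolyTime_Kc`, `mem_queries_Kc`, `length_le_of_mem_queries_Kc`;
* `PromiseCook.L₃ M q Lamp` — the language of `Kc` against the oracle of `Lamp`;
  `L₃_mem_PRel : L₃ ∈ P^{Lamp}` and `L₃_mem_P` (`P^{P} = P`, by
  `mem_PRel_of_polyTimeTuringReducible_holds`, `P_subset_PRel_holds`, `PRel_empty_holds`);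
* `PromiseCook.obs x R` (the oracle seen by `M`: `y ↦ [⟨⟨y, x⟩, R⟩ ∈ Lamp]`), `PromiseCook.Good`
  (it is correct on the promise of `Q₂` for all strings of length `≤ q(|x|)`), `PromiseCook.conf`
  (the conforming oracle: `obs` on short strings, the truth elsewhere), `solvedBy_conf`,
  `mapAgree_conf`, `run_Kc_of_run`, `mem_L₃_of_good` / `notMem_L₃_of_good` — on good coins
  `⟨x, R⟩ ∈ L₃ ↔ x ∈ Q₁.yes` on the promise of `Q₁`;
* `PromiseCook.shortStrings n` (the `< 2^{n+1}` strings of length `≤ n`), `PromiseCook.Bad`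
  (the single-string bad event) and `not_good_subset` (bad coins lie in the union of the
  single-string bad events) — the combinatorial side of the union bound.

## References

* O. Goldreich, *On promise problems: a survey*, LNCS 3895, Springer 2006, 254–290; §1.2,
  Def. 2–3 and the remark following Def. 3 (p. 258) [GoldreichPromise2006].
* S. Arora, B. Barak, *Computational Complexity: A Modern Approach*, CUP 2009, §3.4 (oracle
  machines), §7.4.1 (error reduction, union bound), §A.2 [AroraBarak2009].
-/

noncomputable section

namespace Literature.Computability.Complexity

open _root_.Computability Polynomial Finset Real OracleAlg

open scoped Classical Notation

namespace PromiseCook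

/-! ### Two generic facts -/

/-- **Every query of a query-mapped algorithm is a rewritten query**: if `z` is asked by
`M.mapQuery d` (from any transcript) then `z = d ⟨x, ⟨listBool as', y⟩⟩` for a transcript `as'`
at which `M` asks `y`. [cite: AroraBarak2009, §3.4] -/
theorem mem_queriesAux_mapQuery {β : Type} (M : OracleAlg β) (d : List Bool → List Bool) (O : Oracle)
    (x : List Bool) :
    ∀ (n : ℕ) (as : List (List Bool)) (z : List Bool), z ∈ (M.mapQuery d).queriesAux O x n as →
      ∃ (as' : List (List Bool)) (y : List Bool), M.step x as' = Sum.inl y ∧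
        z = d (boolPair x (boolPair ((encodingList Bool).listBool.encode as') y))
  | 0, _, _, h => by simp at h
  | n + 1, as, z, h => by
    unfold queriesAux at h
    rw [mapQuery_step] at h
    cases hs : M.step x as with
    | inr b => rw [hs] at h; simp at h
    | inl y =>
      rw [hs] at h
      dsimp only at h
      rcases List.mem_cons.1 h with rfl | h
      · exact ⟨as, y, hs, rfl⟩
      · exact mem_queriesAux_mapQuery M d O x n _ z h

/-- Monotonicity of the counting probability under inclusion of events. (Same statement as
`Literature.Computability.QuantumComplexity.uniformProb_mono_set` of
`QuantumComplexity/ExactBosonSamplingHardness.lean` and `….Cryptography.uniformProb_mono` of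
`Cryptography/ShorFactoring.lean`, neither importable below this trunk file; librarian: hoist the
three into `Randomized.lean`.) [cite: AroraBarak2009, §A.2] -/
theorem uniformProb_mono {m : ℕ} {E E' : Set (List Bool)} (h : E ⊆ E') :
    uniformProb m E ≤ uniformProb m E' := by
  unfold uniformProb
  refine div_le_div_of_nonneg_right ?_ (by positivity)
  exact_mod_cast card_le_card fun r hr => by
    simp only [mem_filter, mem_univ, true_and] at hr ⊢
    exact h hr

/-! ### The decoration of the queries -/

/-- **The decoration map** `dec ⟨w, ⟨a, y⟩⟩ = ⟨⟨y, fstP w⟩, sndP w⟩`: on the outer input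
`w = ⟨x, R⟩`, the query `y` (asked after the transcript coded by `a`) becomes the instance
`⟨y, x⟩` of the padded problem, paired with the coins `R`. [cite: GoldreichPromise2006, §1.2 remark after Def. 3 (p. 258)] -/
def dec : List Bool → List Bool :=
  pairFn (pairFn (sndP ∘ sndP) (fstP ∘ fstP)) (sndP ∘ fstP)

/-- The value of `dec` on a decorated query. [folklore] -/
theorem dec_apply (w a y : List Bool) :
    dec (boolPair w (boolPair a y)) = boolPair (boolPair y (fstP w)) (sndP w) := by
  simp [dec, Function.comp]

/-- `dec ∈ FP` (pair plumbing). [cite: AroraBarak2009, Thm. 2.8 (proof: composition)] -/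
theorem dec_mem_FP : dec ∈ FP :=
  pairFn_mem_FP (pairFn_mem_FP (comp_mem_FP sndP_mem_FP sndP_mem_FP) (comp_mem_FP fstP_mem_FP fstP_mem_FP))
    (comp_mem_FP sndP_mem_FP fstP_mem_FP)

/-! ### The machine -/

section Machine

variable (M : OracleAlg Bool) (q : Polynomial ℕ)

/-- **The inner machine**: `M` with queries capped at `q(|x|)`, reading `x = fstP w` from the
outer input `w = ⟨x, R⟩`, its queries decorated by `dec`. [cite: GoldreichPromise2006, §1.2 remark after Def. 3 (p. 258)] -/
def Kin : OracleAlg Bool :=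
  ((M.capQ q false).comap fstP).mapQuery dec

/-- **The deterministic part of the promise-BPP machine for `Q₁`**: the inner machine clocked at
`q(|w|)` rounds. [cite: GoldreichPromise2006, §1.2 remark after Def. 3 (p. 258)] -/
def Kc : OracleAlg Bool :=
  (Kin M q).clock q false

/-- **The witness language**: `Kc` accepts `w` within `q(|w|) + 1` rounds against the language
oracle of `Lamp`. [cite: GoldreichPromise2006, §1.2 remark after Def. 3 (p. 258)] -/
def L₃ (Lamp : Language Bool) : Language Bool :=
  {w | (Kc M q).run (Oracle.ofLanguage Lamp) (q.eval w.length + 1) w = some true}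

/-- The round/query-length polynomial of `Kc`: `4 q + 2 X + 7`. [folklore] -/
def budget : Polynomial ℕ := 4 * q + 2 * X + 7

variable {M}

/-- `Kc` is polynomial-time when `M` is (closure of `IsPolyTime` under cap, comap, query map
and clock, `OracleQueryMap.lean`). [cite: AroraBarak2009, §3.4] -/
theorem isPolyTime_Kc (hM : M.IsPolyTime encodingBoolBool) : (Kc M q).IsPolyTime encodingBoolBool :=
  isPolyTime_clock _
    (isPolyTime_mapQuery _ (isPolyTime_comap _ (isPolyTime_capQ _ hM q false) fstP_mem_FP) dec_mem_FP) q false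

variable (M)

/-- **The shape of the queries of `Kc`** (against any oracle): `⟨⟨y₀, fstP w⟩, sndP w⟩` with
`|y₀| ≤ q(|fstP w|)` (the cap). [cite: AroraBarak2009, §3.4] -/
theorem mem_queries_Kc (f : Oracle) {n : ℕ} {w z : List Bool} (hz : z ∈ (Kc M q).queries f n w) :
    ∃ y₀ : List Bool, z = boolPair (boolPair y₀ (fstP w)) (sndP w) ∧ y₀.length ≤ q.eval (fstP w).length := by
  have hz' : z ∈ (Kin M q).queriesAux f w n [] := queries_clock_subset _ q false f w n hz
  obtain ⟨as', y, hs, rfl⟩ := mem_queriesAux_mapQuery _ dec f w n [] z hz'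
  refine ⟨y, dec_apply _ _ _, ?_⟩
  rw [comap_step] at hs
  exact capQ_step_eq_inl hs

/-- **The queries of `Kc` are polynomially long**: `≤ budget(|w|)`. [cite: AroraBarak2009, §3.4] -/
theorem length_le_of_mem_queries_Kc (f : Oracle) {n : ℕ} {w z : List Bool}
    (hz : z ∈ (Kc M q).queries f n w) : z.length ≤ (budget q).eval w.length := by
  obtain ⟨y₀, rfl, hy₀⟩ := mem_queries_Kc M q f hz
  have hparts := length_boolUnpair_parts_le w
  have hx : (fstP w).length ≤ w.length := by
    show (boolUnpair w).1.length ≤ w.length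
    omega
  have hR : 2 * (fstP w).length + (sndP w).length ≤ w.length := hparts
  have hq : q.eval (fstP w).length ≤ q.eval w.length := TM2Iter.eval_mono q hx
  simp only [length_boolPair, budget, eval_add, eval_mul, eval_X, eval_ofNat]
  omega

/-- **`L₃ ∈ P^{Lamp}`**: `Kc` is polynomial-time, always answers within `q(|w|) + 1` rounds (the
clock), and asks polynomially long queries. [cite: GoldreichPromise2006, §1.2 remark after Def. 3 (p. 258)] -/
theorem L₃_mem_PRel (hM : M.IsPolyTime encodingBoolBool) (Lamp : Language Bool) :
    L₃ M q Lamp ∈ PRel (Oracle.ofLanguage Lamp) := by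
  refine ⟨Kc M q, isPolyTime_Kc q hM, budget q, fun w => ⟨?_, fun z hz => length_le_of_mem_queries_Kc M q _ hz⟩⟩
  have hsome : ((Kc M q).run (Oracle.ofLanguage Lamp) (q.eval w.length + 1) w).isSome :=
    run_clock_isSome _ q false _ w (Nat.lt_succ_self _)
  obtain ⟨b, hb⟩ := Option.isSome_iff_exists.1 hsome
  have hfuel : q.eval w.length + 1 ≤ (budget q).eval w.length := by
    simp only [budget, eval_add, eval_mul, eval_X, eval_ofNat]; omega
  rw [run_mono _ _ _ hfuel hb]
  congr 1
  by_cases hw : w ∈ L₃ M q Lamp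
  · rw [((L₃ M q Lamp).mem_iff_boolIndicator w).1 hw]
    have hw' : (Kc M q).run (Oracle.ofLanguage Lamp) (q.eval w.length + 1) w = some true := hw
    rw [hb] at hw'
    exact Option.some.inj hw'
  · rw [((L₃ M q Lamp).notMem_iff_boolIndicator w).1 hw]
    have hw' : (Kc M q).run (Oracle.ofLanguage Lamp) (q.eval w.length + 1) w ≠ some true := hw
    rw [hb] at hw'
    cases b
    · rfl
    · exact absurd rfl hw'

/-- **`L₃ ∈ P`** for `Lamp ∈ P`: `L₃ ∈ P^{Lamp}`, `Lamp ∈ P ⊆ P^∅`, and `P^∅` is closed under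
Cook reductions (`P^{P^∅} = P^∅ = P`). [cite: GoldreichPromise2006, §1.2 remark after Def. 3 (p. 258)] -/
theorem L₃_mem_P (hM : M.IsPolyTime encodingBoolBool) {Lamp : Language Bool} (hLamp : Lamp ∈ Classes.P) :
    L₃ M q Lamp ∈ Classes.P := by
  have hred : L₃ M q Lamp ≤ᵀₚ Lamp := L₃_mem_PRel M q hM Lamp
  have h1 : L₃ M q Lamp ∈ PRel Oracle.empty :=
    mem_PRel_of_polyTimeTuringReducible_holds hred (P_subset_PRel_holds Oracle.empty hLamp)
  rwa [PRel_empty_holds] at h1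

end Machine

/-! ### Good coins: the capped run cannot tell the observed oracle from a conforming one -/

section GoodCoins

variable (M : OracleAlg Bool) (q : Polynomial ℕ) (Q₂ : PromiseProblem) (Lamp : Language Bool)

/-- **The observed oracle** on outer input `x` and coins `R`: the query `y` of `M` is answered by
the bit `[⟨⟨y, x⟩, R⟩ ∈ Lamp]` — a genuine function of `y`, because the same coins serve every
query. [cite: GoldreichPromise2006, §1.2 Def. 3 (functions σ)] -/
def obs (x R : List Bool) : Oracle :=
  fun y => Oracle.ofLanguage Lamp (boolPair (boolPair y x) R)

/-- **Good coins**: the observed oracle is correct on every string of length `≤ q(|x|)` that is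
on the promise of `Q₂`. [cite: AroraBarak2009, §7.4.1 (union bound over the queries)] -/
def Good (x R : List Bool) : Prop :=
  ∀ y : List Bool, y.length ≤ q.eval x.length →
    (y ∈ Q₂.yes → boolPair (boolPair y x) R ∈ Lamp) ∧ (y ∈ Q₂.no → boolPair (boolPair y x) R ∉ Lamp)

/-- **The conforming oracle**: the observed oracle on strings of length `≤ q(|x|)`, the truth
(`1` on `Q₂.yes`, `0` elsewhere) on longer strings. [cite: GoldreichPromise2006, §1.2 Def. 3 (functions σ conforming with Π')] -/
def conf (x R : List Bool) : Oracle :=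
  fun y => if y.length ≤ q.eval x.length then obs Lamp x R y else encodeBool (Q₂.yes.boolIndicator y)

variable {q Q₂ Lamp}

/-- **On good coins the conforming oracle conforms with `Q₂`** (`SolvedBy`): answers of length
`1`, `[true]` on YES and `[false]` on NO instances (disjointness of `Q₂` for the long NO
instances). [cite: GoldreichPromise2006, §1.2 Def. 3] -/
theorem solvedBy_conf {x R : List Bool} (hdisj : Q₂.Disjoint) (hgood : Good q Q₂ Lamp x R) :
    Q₂.SolvedBy (conf q Q₂ Lamp x R) := by
  refine ⟨fun y => ?_, fun y hy => ?_, fun y hy => ?_⟩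
  · unfold conf obs
    split_ifs <;> simp [encodeBool]
  · unfold conf
    split_ifs with h
    · unfold obs
      rw [Oracle.ofLanguage_apply, (Set.mem_iff_boolIndicator _ _).1 ((hgood y h).1 hy)]
      rfl
    · rw [(Set.mem_iff_boolIndicator _ _).1 hy]
      rfl
  · unfold conf
    split_ifs with h
    · unfold obs
      rw [Oracle.ofLanguage_apply, (Set.notMem_iff_boolIndicator _ _).1 ((hgood y h).2 hy)]
      rfl
    · have hy' : y ∉ Q₂.yes := fun h' => Set.disjoint_left.1 hdisj h' hy
      rw [(Set.notMem_iff_boolIndicator _ _).1 hy']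
      rfl

variable (q Q₂ Lamp)

/-- **Agreement of the oracles along the capped run** (`MapAgree` of `OracleQueryMap.lean`): at
every live round of the capped machine run with the conforming oracle, the language oracle of
`Lamp` answers the decorated query as the conforming oracle answers the query — because a capped
query has length `≤ q(|x|)`, where the conforming oracle IS the observed one. Holds for all coins.
[cite: AroraBarak2009, §3.4] -/
theorem mapAgree_conf (x R : List Bool) :
    MapAgree ((M.capQ q false).comap fstP) dec (Oracle.ofLanguage Lamp) (conf q Q₂ Lamp x R) (boolPair x R) := by
  intro i y _ hstep
  rw [comap_step, fstP_boolPair] at hstep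
  have hy : y.length ≤ q.eval x.length := capQ_step_eq_inl hstep
  rw [dec_apply, fstP_boolPair, sndP_boolPair]
  unfold conf
  rw [if_pos hy]
  rfl

/-- **The promise-BPP machine reproduces the run of `M` with the conforming oracle**: if that run
outputs `b` within `q(|x|)` rounds asking queries of length `≤ q(|x|)` (as Definition 3 guarantees
on the promise of `Q₁` when the oracle conforms), then `Kc` outputs `b` on `⟨x, R⟩` against the
language oracle of `Lamp` within `q(|⟨x, R⟩|) + 1` rounds. [cite: GoldreichPromise2006, §1.2 remark after Def. 3 (p. 258)] -/
theorem run_Kc_of_run {x R : List Bool} {b : Bool}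
    (hrun : M.run (conf q Q₂ Lamp x R) (q.eval x.length) x = some b)
    (hcap : ∀ y ∈ M.queries (conf q Q₂ Lamp x R) (q.eval x.length) x, y.length ≤ q.eval x.length) :
    (Kc M q).run (Oracle.ofLanguage Lamp) (q.eval (boolPair x R).length + 1) (boolPair x R) = some b := by
  have hcapQ : (M.capQ q false).run (conf q Q₂ Lamp x R) (q.eval x.length) x = some b := by
    rw [(run_capQ M q false _ x _ hcap).1, hrun]
  have hagree := mapAgree_conf M q Q₂ Lamp x R
  have hK₀ : (Kin M q).run (Oracle.ofLanguage Lamp) (q.eval (boolPair x R).length) (boolPair x R) = some b := by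
    have hxw : q.eval x.length ≤ q.eval (boolPair x R).length :=
      TM2Iter.eval_mono _ (by rw [length_boolPair]; omega)
    refine run_mono _ _ _ hxw ?_
    rw [Kin, run_mapQuery _ _ _ _ _ hagree]
    show OracleAlg.runAux _ _ _ _ [] = _
    rw [runAux_comap, fstP_boolPair]
    exact hcapQ
  exact run_clock_of_run _ q false _ _ hK₀ (Nat.le_succ _)

/-- On good coins, for `x ∈ Q₁.yes`: `⟨x, R⟩ ∈ L₃`. [cite: GoldreichPromise2006, §1.2 remark after Def. 3 (p. 258)] -/
theorem mem_L₃_of_good {Q₁ : PromiseProblem} (hdisj : Q₂.Disjoint)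
    (hcook : ∀ O : Oracle, Q₂.SolvedBy O → ∀ x : List Bool,
      (x ∈ Q₁.yes → M.run O (q.eval x.length) x = some true ∧
          ∀ y ∈ M.queries O (q.eval x.length) x, y.length ≤ q.eval x.length) ∧
      (x ∈ Q₁.no → M.run O (q.eval x.length) x = some false ∧
          ∀ y ∈ M.queries O (q.eval x.length) x, y.length ≤ q.eval x.length))
    {x R : List Bool} (hx : x ∈ Q₁.yes) (hgood : Good q Q₂ Lamp x R) : boolPair x R ∈ L₃ M q Lamp := by
  obtain ⟨hrun, hcap⟩ := (hcook _ (solvedBy_conf hdisj hgood) x).1 hx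
  show (Kc M q).run (Oracle.ofLanguage Lamp) (q.eval (boolPair x R).length + 1) (boolPair x R) = some true
  exact run_Kc_of_run M q Q₂ Lamp hrun hcap

/-- On good coins, for `x ∈ Q₁.no`: `⟨x, R⟩ ∉ L₃`. [cite: GoldreichPromise2006, §1.2 remark after Def. 3 (p. 258)] -/
theorem notMem_L₃_of_good {Q₁ : PromiseProblem} (hdisj : Q₂.Disjoint)
    (hcook : ∀ O : Oracle, Q₂.SolvedBy O → ∀ x : List Bool,
      (x ∈ Q₁.yes → M.run O (q.eval x.length) x = some true ∧
          ∀ y ∈ M.queries O (q.eval x.length) x, y.length ≤ q.eval x.length) ∧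
      (x ∈ Q₁.no → M.run O (q.eval x.length) x = some false ∧
          ∀ y ∈ M.queries O (q.eval x.length) x, y.length ≤ q.eval x.length))
    {x R : List Bool} (hx : x ∈ Q₁.no) (hgood : Good q Q₂ Lamp x R) : boolPair x R ∉ L₃ M q Lamp := by
  obtain ⟨hrun, hcap⟩ := (hcook _ (solvedBy_conf hdisj hgood) x).2 hx
  have h := run_Kc_of_run M q Q₂ Lamp hrun hcap
  show (Kc M q).run (Oracle.ofLanguage Lamp) (q.eval (boolPair x R).length + 1) (boolPair x R) ≠ some true
  rw [h]
  simp

end GoodCoins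

/-! ### Bad coins are rare: the union bound over all short strings -/

section Probability

/-- All bit strings of length `≤ n`, as a finset. [folklore] -/
def shortStrings (n : ℕ) : Finset (List Bool) :=
  (range (n + 1)).biUnion fun m => (univ : Finset (Fin m → Bool)).image List.ofFn

/-- A string of length `≤ n` is a short string. [folklore] -/
theorem mem_shortStrings {n : ℕ} {y : List Bool} (hy : y.length ≤ n) : y ∈ shortStrings n := by
  refine mem_biUnion.2 ⟨y.length, mem_range.2 (Nat.lt_succ_of_le hy), mem_image.2 ⟨y.get, mem_univ _, ?_⟩⟩
  exact List.ofFn_get y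

/-- `∑_{m ≤ n} 2^m ≤ 2^{n+1}`. [folklore] -/
theorem sum_two_pow_le (n : ℕ) : ∑ m ∈ range (n + 1), 2 ^ m ≤ 2 ^ (n + 1) := by
  induction n with
  | zero => simp
  | succ n ih => rw [sum_range_succ, pow_succ]; omega

/-- There are at most `2^{n+1}` strings of length `≤ n`. [folklore] -/
theorem card_shortStrings_le (n : ℕ) : (shortStrings n).card ≤ 2 ^ (n + 1) := by
  refine card_biUnion_le.trans ((sum_le_sum fun m _ => ?_).trans (sum_two_pow_le n))
  exact card_image_le.trans (by simp)

variable (q : Polynomial ℕ) (Q₂ : PromiseProblem) (Lamp : Language Bool)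

/-- The bad event of a single string `y` for the outer input `x`: `y` is on the promise of `Q₂`
and the observed oracle errs on it. [cite: AroraBarak2009, §7.4.1] -/
def Bad (x y : List Bool) : Set (List Bool) :=
  {R | (y ∈ Q₂.yes ∧ boolPair (boolPair y x) R ∉ Lamp) ∨ (y ∈ Q₂.no ∧ boolPair (boolPair y x) R ∈ Lamp)}

/-- **Bad coins lie in the union of the single-string bad events** over the short strings. [cite: AroraBarak2009, §7.4.1 (union bound)] -/
theorem not_good_subset (x : List Bool) :
    {R | ¬ Good q Q₂ Lamp x R} ⊆ ⋃ y ∈ shortStrings (q.eval x.length), Bad Q₂ Lamp x y := by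
  intro R hR
  simp only [Set.mem_setOf_eq, Good, not_forall] at hR
  obtain ⟨y, hy, h⟩ := hR
  refine Set.mem_iUnion₂.2 ⟨y, mem_shortStrings hy, ?_⟩
  simp only [Bad, Set.mem_setOf_eq]
  by_contra hc
  push Not at hc
  exact h hc


end Probability

end PromiseCook

end Literature.Computability.Complexity

end
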